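import Summits.NavierStokesRegularity.NavierStokesRegularity.Theorems.TaoLadderRungThreeTargetR64
import HarnessLib

/-!
# Endpoint leaf TL-M3 `TaoLadderRungThree.Target` from the rung of record TL-M3-R64

Closes the leaf item `stmt-NavierStokesRegularity-20421`
(`Summit.NavierStokesRegularity.NavierStokesRegularity.Theses.TaoLadderRungThree.Target`: SOME spread
`R ≥ 1`, some `R`-comparable symmetric cancelling four-mode table `α` on Tao's topology and one-shell
datum amplitudes `X₀` with `TaoCascade.NoGlobalCascade 1 α X₀`) as the immediate corollary `R := 64` of
the PROVED rung of record `TaoLadderRungThree.TargetR64` (item stmt-NavierStokesRegularity-24294,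
`Theorems.taoLadderRungThree_targetR64_proof`, file `TaoLadderRungThreeTargetR64.lean`), itself the
deciding theorem `Theses.CompletionRelayChain.closes` of route `CompletionRelayChain` applied to its five
landed items (24851 `RelayTable`, 24850 `RelayFrontStep`, 24852–24854).

No mathematical content is added here beyond `1 ≤ 64`: the route file's own docstring records
"`TargetR64 → Target` (R := 64)". The witness is a table of BOUNDED spread (64), not Tao's hierarchical
Table 1 (cf. the conditional `RungThreeTaoMechanism.taoLadderRungThree_target_of_thm62_at_one`).

COMPUTATIONAL CONE (inherited, unchanged): through `RelayFrontStep_of` the proof depends on the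
`native_decide` auxiliary axioms of the 41 gate-verified Phase-I certificate data modules
`…Theorems.CompletionRelayChainPhaseIRun00` … `Run40` (computational lane), besides `propext`,
`Classical.choice`, `Quot.sound`.

MODEL statement only (Tao's averaged dyadic cascade, D-0061 ladder rung TL-M3 endpoint leaf). NOTHING
here is a statement about the Navier–Stokes equations.
-/

set_option linter.dupNamespace false

namespace Summit.NavierStokesRegularity.NavierStokesRegularity.Theorems

/-- **TL-M3 endpoint leaf `Target` (MODEL).** There are a spread bound `R ≥ 1` (namely `R = 64`), an
`R`-comparable symmetric cancelling four-mode coefficient table `α` on Tao's topology and one-shell datum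
amplitudes `X₀` with `TaoCascade.NoGlobalCascade 1 α X₀` — the leaf `TaoLadderRungThree.Target` BY NAME,
from the proved rung of record `taoLadderRungThree_targetR64_proof` with `R := 64`. A statement about
Tao's model cascade, not about Navier–Stokes. -/
theorem taoLadderRungThree_target_proof :
    Summit.NavierStokesRegularity.NavierStokesRegularity.Theses.TaoLadderRungThree.Target :=
  ⟨64, by norm_num, taoLadderRungThree_targetR64_proof⟩

end Summit.NavierStokesRegularity.NavierStokesRegularity.Theorems
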